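import Mathlib.Analysis.Calculus.MeanValue
import Literature.Analysis.FluidPDE.TaoEnstrophyLocalisationProofs
import HarnessLib

/-!
# Pointwise calculus of an explicit stirring cell

Analysis/FluidPDE support file (everything proved; no definitions, no named facts). A *stirring
cell* is a compactly supported smooth triple `(W, R, f)` — velocity, symmetric Reynolds stress,
divergence-free force — solving the stationary Euler–Reynolds system
`div (W ⊗ W + R) = f`, `div W = 0` identically (a compactly supported *subsolution* with source,
in the vocabulary of De Lellis–Székelyhidi, Arch. Ration. Mech. Anal. 195 (2010) §2), with
prescribed power `∫ ⟪f, W⟫`. The construction carried out in `StirringCell.lean` is elementary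
vector calculus on a finite-dimensional real inner product space `E` with an orthonormal frame
`b` (coordinates `vᵢ = ⟪bᵢ, v⟫`, `∂ᵢ = D(·)(bᵢ)`, `(∇w)ᵢⱼ = ∂ⱼwᵢ = ⟪bᵢ, Dw bⱼ⟫`), and this file
supplies its pointwise identities, for a smooth divergence-free field `W` and a real `κ`:

* the symmetric gradient `Tᵢⱼ = κ (∂ᵢWⱼ + ∂ⱼWᵢ)` has row divergence `Σⱼ ∂ⱼ Tᵢⱼ = κ (ΔW)ᵢ`
  (`sum_fderiv_symGrad_eq`: `Σⱼ ∂ⱼ∂ᵢWⱼ = div (∂ᵢ W) = 0`, `Σⱼ ∂ⱼ∂ⱼ Wᵢ = (ΔW)ᵢ`);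
* the Leibniz expansion `Σᵢⱼ ∂ⱼ(Tᵢⱼ wᵢ) = Σᵢⱼ Tᵢⱼ ∂ⱼwᵢ + Σᵢ (Σⱼ ∂ⱼTᵢⱼ) wᵢ`
  (`sum_fderiv_symGrad_mul_eq`) and the algebra `⟪W, Dw W⟫ = Σᵢⱼ WᵢWⱼ ∂ⱼwᵢ`, combined into the
  *cell integrand identity*
  `⟪W, Dw·W⟫ + Σᵢⱼ (Tᵢⱼ − WᵢWⱼ) ∂ⱼwᵢ + ⟪κΔW, w⟫ = Σᵢⱼ ∂ⱼ(Tᵢⱼ wᵢ)` (`stirring_integrand_eq`), whose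
  integral vanishes for compactly supported `w` (no boundary terms);
* an explicit planar divergence-free field `W = ∂₁ψ b₀ − ∂₀ψ b₁` built from a scalar `ψ` and two
  frame vectors (`contDiff_planarField`, `tsupport_planarField_subset`, `divergence_planarField`),
  which is not identically zero as soon as `ψ` takes different values at a point `p` and at a point
  of the `b₀`-axis through `p` (`exists_planarField_ne_zero`: otherwise `∂₀ψ ≡ 0` and `ψ` would be
  constant on that axis, by the mean value theorem).

Deliberately not here: anything involving integrals (see `StirringCell.lean`).

## Mathlib / tree search

Reused from the tree: `divergence_eq_sum_inner_fderiv`, `laplacian_eq_sum_fderiv_fderiv`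
(`VectorCalculus`, `WholeSpaceIBP`), `fderiv_fderiv_apply_eq`, `traceCLM_smulRight`,
`divergence_eq_traceCLM`, `IsDivFree.fderiv_apply` (`TaoEnstrophyLocalisationProofs`); Mathlib:
`is_const_of_deriv_eq_zero`, `ContDiffAt.isSymmSndFDerivAt`, `OrthonormalBasis.sum_repr'`,
`OrthonormalBasis.sum_inner_mul_inner`. `lean search 'stirring|StirringCell|subsolution'`: no
stirring cell in the tree (the torus-side `Torus.antidivergence` of `Antidivergence.lean` is a
different, Fourier-based device).

## References

* C. De Lellis, L. Székelyhidi Jr., *On admissibility criteria for weak solutions of the Euler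
  equations*, Arch. Ration. Mech. Anal. 195 (2010), §2 (subsolutions, Reynolds stress).
* A. J. Majda, A. L. Bertozzi, *Vorticity and Incompressible Flow* (CUP 2002), §1.1 (vector
  identities).
-/

noncomputable section

open Set Function Filter Metric
open scoped RealInnerProductSpace Laplacian ContDiff Topology

namespace Literature.Analysis.FluidPDE

variable {E : Type*} [NormedAddCommGroup E] [InnerProductSpace ℝ E] [FiniteDimensional ℝ E]
variable {ι : Type*} [Fintype ι]

/-! ### Linear algebra in an orthonormal frame -/

omit [FiniteDimensional ℝ E] in
/-- `⟪a, L a⟫ = Σᵢⱼ aᵢ aⱼ (L bⱼ)ᵢ` in an orthonormal frame `b` (the identity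
`⟪W, Dw·W⟫ = W⊗W : ∇w`). [folklore] -/
theorem inner_clm_apply_self_eq_sum_sum (b : OrthonormalBasis ι ℝ E) (a : E) (L : E →L[ℝ] E) :
    ⟪a, L a⟫ = ∑ i, ∑ j, ⟪b i, a⟫ * ⟪b j, a⟫ * ⟪b i, L (b j)⟫ := by
  have ha : L a = ∑ j, ⟪b j, a⟫ • L (b j) := by
    conv_lhs => rw [← b.sum_repr' a]
    simp only [map_sum, map_smul]
  rw [ha, inner_sum, Finset.sum_comm]
  refine Finset.sum_congr rfl fun j _ => ?_
  rw [inner_smul_right, ← b.sum_inner_mul_inner a (L (b j)), Finset.mul_sum]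
  exact Finset.sum_congr rfl fun i _ => by rw [real_inner_comm a (b i)]; ring

omit [FiniteDimensional ℝ E] in
/-- Parseval in an orthonormal frame: `⟪a, v⟫ = Σᵢ aᵢ vᵢ`. [folklore] -/
theorem inner_eq_sum_inner_mul_inner (b : OrthonormalBasis ι ℝ E) (a v : E) :
    ⟪a, v⟫ = ∑ i, ⟪b i, a⟫ * ⟪b i, v⟫ := by
  rw [← b.sum_inner_mul_inner a v]
  exact Finset.sum_congr rfl fun i _ => by rw [real_inner_comm a (b i)]

/-! ### Second derivatives of a smooth field in a frame -/

section Field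

variable {W : E → E}

omit [FiniteDimensional ℝ E] in
/-- The coordinate functions `y ↦ ⟪u, DW(y) v⟫` of the velocity gradient of a `C²` field have
derivative `h ↦ ⟪u, D²W(y) v h⟫` (Schwarz, through the tree's `fderiv_fderiv_apply_eq`). [folklore] -/
theorem hasFDerivAt_inner_fderiv_apply (hW : ContDiff ℝ 2 W) (x u v : E) :
    HasFDerivAt (fun y => ⟪u, fderiv ℝ W y v⟫)
      ((innerSL ℝ u).comp (fderiv ℝ (fderiv ℝ W) x v)) x := by
  have hd : DifferentiableAt ℝ (fun y => fderiv ℝ W y v) x :=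
    (((hW.fderiv_right (m := 1) le_rfl).clm_apply contDiff_const).differentiable one_ne_zero) x
  have h1 : HasFDerivAt (fun y => fderiv ℝ W y v) (fderiv ℝ (fderiv ℝ W) x v) x := by
    rw [← fderiv_fderiv_apply_eq hW x v]
    exact hd.hasFDerivAt
  exact (innerSL ℝ u).hasFDerivAt.comp x h1

omit [FiniteDimensional ℝ E] in
/-- The entries `Tᵢⱼ = κ (⟪bⱼ, DW bᵢ⟫ + ⟪bᵢ, DW bⱼ⟫)` of the symmetric gradient of a `C²` field are
differentiable, with `DTᵢⱼ(x) h = κ (⟪bⱼ, D²W bᵢ h⟫ + ⟪bᵢ, D²W bⱼ h⟫)`. [folklore] -/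
theorem hasFDerivAt_symGrad (b : OrthonormalBasis ι ℝ E) (hW : ContDiff ℝ 2 W) (κ : ℝ) (x : E)
    (i j : ι) :
    HasFDerivAt (fun y => κ * (⟪b j, fderiv ℝ W y (b i)⟫ + ⟪b i, fderiv ℝ W y (b j)⟫))
      (κ • ((innerSL ℝ (b j)).comp (fderiv ℝ (fderiv ℝ W) x (b i)) +
        (innerSL ℝ (b i)).comp (fderiv ℝ (fderiv ℝ W) x (b j)))) x :=
  ((hasFDerivAt_inner_fderiv_apply hW x (b j) (b i)).add
    (hasFDerivAt_inner_fderiv_apply hW x (b i) (b j))).const_mul κ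

/-- **Row divergence of the symmetric gradient.** For a divergence-free `W ∈ C²(E; E)` and
`Tᵢⱼ = κ (∂ᵢWⱼ + ∂ⱼWᵢ)`: `Σⱼ ∂ⱼ Tᵢⱼ = κ (ΔW)ᵢ` (`Σⱼ ∂ⱼ∂ᵢWⱼ = div (∂ᵢ W) = 0`,
`Σⱼ ∂ⱼ∂ⱼWᵢ = (ΔW)ᵢ`; Majda–Bertozzi, §1.1). [folklore] -/
theorem sum_fderiv_symGrad_eq (b : OrthonormalBasis ι ℝ E) (hW : ContDiff ℝ 2 W)
    (hdiv : VectorCalculus.IsDivFree W) (κ : ℝ) (x : E) (i : ι) :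
    ∑ j, fderiv ℝ (fun y => κ * (⟪b j, fderiv ℝ W y (b i)⟫ + ⟪b i, fderiv ℝ W y (b j)⟫)) x (b j) =
      κ * ⟪b i, (Δ W) x⟫ := by
  have hterm : ∀ j,
      fderiv ℝ (fun y => κ * (⟪b j, fderiv ℝ W y (b i)⟫ + ⟪b i, fderiv ℝ W y (b j)⟫)) x (b j) =
        κ * (⟪b j, fderiv ℝ (fderiv ℝ W) x (b i) (b j)⟫ +
          ⟪b i, fderiv ℝ (fderiv ℝ W) x (b j) (b j)⟫) := by
    intro j
    rw [(hasFDerivAt_symGrad b hW κ x i j).fderiv]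
    rfl
  simp_rw [hterm]
  rw [← Finset.mul_sum, Finset.sum_add_distrib]
  congr 1
  -- first sum: `div (∂ᵢ W) = 0`
  have h1 : ∑ j, ⟪b j, fderiv ℝ (fderiv ℝ W) x (b i) (b j)⟫ = 0 := by
    have h := VectorCalculus.IsDivFree.fderiv_apply hW hdiv (b i) x
    rwa [divergence_eq_sum_inner_fderiv b, fderiv_fderiv_apply_eq hW x (b i)] at h
  -- second sum: the Laplacian in the frame
  have h2 : ∑ j, ⟪b i, fderiv ℝ (fderiv ℝ W) x (b j) (b j)⟫ = ⟪b i, (Δ W) x⟫ := by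
    rw [laplacian_eq_sum_fderiv_fderiv b hW x, inner_sum]
    refine Finset.sum_congr rfl fun j _ => ?_
    rw [fderiv_fderiv_apply_eq hW x (b j)]
  rw [h1, h2, zero_add]

omit [FiniteDimensional ℝ E] in
/-- Leibniz rule for one entry: `∂ⱼ(Tᵢⱼ wᵢ) = Tᵢⱼ ∂ⱼwᵢ + (∂ⱼTᵢⱼ) wᵢ` at a point where `w` is
differentiable (`W ∈ C²`). [folklore] -/
theorem fderiv_symGrad_mul_apply (b : OrthonormalBasis ι ℝ E) (hW : ContDiff ℝ 2 W) (κ : ℝ)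
    {w : E → E} {x : E} (hw : DifferentiableAt ℝ w x) (i j : ι) :
    fderiv ℝ (fun y => κ * (⟪b j, fderiv ℝ W y (b i)⟫ + ⟪b i, fderiv ℝ W y (b j)⟫) * ⟪b i, w y⟫) x
        (b j) =
      κ * (⟪b j, fderiv ℝ W x (b i)⟫ + ⟪b i, fderiv ℝ W x (b j)⟫) * ⟪b i, fderiv ℝ w x (b j)⟫ +
        fderiv ℝ (fun y => κ * (⟪b j, fderiv ℝ W y (b i)⟫ + ⟪b i, fderiv ℝ W y (b j)⟫)) x (b j) *
          ⟪b i, w x⟫ := by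
  have hT := (hasFDerivAt_symGrad b hW κ x i j).differentiableAt
  have hwi : HasFDerivAt (fun y => ⟪b i, w y⟫) ((innerSL ℝ (b i)).comp (fderiv ℝ w x)) x :=
    (innerSL ℝ (b i)).hasFDerivAt.comp x hw.hasFDerivAt
  rw [fderiv_fun_mul hT hwi.differentiableAt, hwi.fderiv]
  simp only [_root_.add_apply, _root_.FunLike.coe_smul, Pi.smul_apply, smul_eq_mul,
    ContinuousLinearMap.coe_comp, Function.comp_apply, innerSL_apply_apply]
  ring

omit [FiniteDimensional ℝ E] in
/-- **Leibniz expansion.** For `W ∈ C²`, `Tᵢⱼ = κ (∂ᵢWⱼ + ∂ⱼWᵢ)` and a field `w` differentiable at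
`x`: `Σᵢⱼ ∂ⱼ(Tᵢⱼ wᵢ) = Σᵢⱼ Tᵢⱼ ∂ⱼwᵢ + Σᵢ (Σⱼ ∂ⱼTᵢⱼ) wᵢ` at `x`. [folklore] -/
theorem sum_fderiv_symGrad_mul_eq (b : OrthonormalBasis ι ℝ E) (hW : ContDiff ℝ 2 W) (κ : ℝ)
    {w : E → E} {x : E} (hw : DifferentiableAt ℝ w x) :
    ∑ i, ∑ j, fderiv ℝ
        (fun y => κ * (⟪b j, fderiv ℝ W y (b i)⟫ + ⟪b i, fderiv ℝ W y (b j)⟫) * ⟪b i, w y⟫) x (b j)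
      = ∑ i, ∑ j, κ * (⟪b j, fderiv ℝ W x (b i)⟫ + ⟪b i, fderiv ℝ W x (b j)⟫) *
          ⟪b i, fderiv ℝ w x (b j)⟫ +
        ∑ i, (∑ j, fderiv ℝ
          (fun y => κ * (⟪b j, fderiv ℝ W y (b i)⟫ + ⟪b i, fderiv ℝ W y (b j)⟫)) x (b j)) *
            ⟪b i, w x⟫ := by
  simp_rw [fderiv_symGrad_mul_apply b hW κ hw, Finset.sum_add_distrib, Finset.sum_mul]

/-- **The cell integrand identity.** For a divergence-free `W ∈ C²(E; E)`, `κ ∈ ℝ`,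
`Tᵢⱼ = κ (∂ᵢWⱼ + ∂ⱼWᵢ)`, the Reynolds stress `Sᵢⱼ = Tᵢⱼ − WᵢWⱼ` and the force `f = κ ΔW`, and any
field `w` differentiable at `x`:
`⟪W, Dw·W⟫ + Σᵢⱼ Sᵢⱼ ⟪bᵢ, Dw bⱼ⟫ + ⟪f, w⟫ = Σᵢⱼ ∂ⱼ (Tᵢⱼ wᵢ)` at `x` — i.e. `div (W⊗W + S) = f`
tested against `w`, in divergence form. [folklore] -/
theorem stirring_integrand_eq (b : OrthonormalBasis ι ℝ E) (hW : ContDiff ℝ 2 W)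
    (hdiv : VectorCalculus.IsDivFree W) (κ : ℝ) {w : E → E} {x : E}
    (hw : DifferentiableAt ℝ w x) :
    ⟪W x, fderiv ℝ w x (W x)⟫ +
        ∑ i, ∑ j, (κ * (⟪b j, fderiv ℝ W x (b i)⟫ + ⟪b i, fderiv ℝ W x (b j)⟫) -
          ⟪b i, W x⟫ * ⟪b j, W x⟫) * ⟪b i, fderiv ℝ w x (b j)⟫ + ⟪κ • (Δ W) x, w x⟫ =
      ∑ i, ∑ j, fderiv ℝ
        (fun y => κ * (⟪b j, fderiv ℝ W y (b i)⟫ + ⟪b i, fderiv ℝ W y (b j)⟫) * ⟪b i, w y⟫) x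
          (b j) := by
  rw [sum_fderiv_symGrad_mul_eq b hW κ hw]
  simp_rw [sum_fderiv_symGrad_eq b hW hdiv κ x]
  have h3 : ⟪(Δ W) x, w x⟫ = ∑ i, ⟪b i, (Δ W) x⟫ * ⟪b i, w x⟫ :=
    inner_eq_sum_inner_mul_inner b _ _
  rw [inner_clm_apply_self_eq_sum_sum b, real_inner_smul_left, h3, Finset.mul_sum]
  congr 1
  · rw [← Finset.sum_add_distrib]
    refine Finset.sum_congr rfl fun i _ => ?_
    rw [← Finset.sum_add_distrib]
    exact Finset.sum_congr rfl fun j _ => by ring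
  · exact Finset.sum_congr rfl fun i _ => by ring

end Field

/-! ### An explicit planar divergence-free field -/

section Planar

variable {ψ : E → ℝ} {W : E → E} (b : OrthonormalBasis ι ℝ E) {i₀ i₁ : ι}

omit [FiniteDimensional ℝ E] in
/-- The planar field `W = ∂₁ψ b₀ − ∂₀ψ b₁` of a smooth scalar `ψ` is smooth. [folklore] -/
theorem contDiff_planarField (hψ : ContDiff ℝ ∞ ψ)
    (hW : W = fun x => (fderiv ℝ ψ x (b i₁)) • b i₀ - (fderiv ℝ ψ x (b i₀)) • b i₁) :
    ContDiff ℝ ∞ W := by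
  rw [hW]
  exact (((hψ.fderiv_right le_rfl).clm_apply contDiff_const).smul contDiff_const).sub
    (((hψ.fderiv_right le_rfl).clm_apply contDiff_const).smul contDiff_const)

omit [FiniteDimensional ℝ E] in
/-- The planar field vanishes off the topological support of `ψ`. [folklore] -/
theorem planarField_eq_zero_of_notMem_tsupport
    (hW : W = fun x => (fderiv ℝ ψ x (b i₁)) • b i₀ - (fderiv ℝ ψ x (b i₀)) • b i₁) {x : E}
    (hx : x ∉ tsupport ψ) : W x = 0 := by
  rw [hW]
  simp [fderiv_of_notMem_tsupport ℝ hx]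

omit [FiniteDimensional ℝ E] in
/-- The planar field is supported in the topological support of `ψ`. [folklore] -/
theorem tsupport_planarField_subset
    (hW : W = fun x => (fderiv ℝ ψ x (b i₁)) • b i₀ - (fderiv ℝ ψ x (b i₀)) • b i₁) :
    tsupport W ⊆ tsupport ψ :=
  closure_minimal (fun _ hx => by_contra fun h =>
    hx (planarField_eq_zero_of_notMem_tsupport b hW h)) (isClosed_tsupport ψ)

/-- **The planar field is divergence free**: `div (∂₁ψ b₀ − ∂₀ψ b₁) = ∂₀∂₁ψ − ∂₁∂₀ψ = 0` for
`ψ ∈ C²` (Schwarz). [folklore] -/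
theorem divergence_planarField (hψ : ContDiff ℝ 2 ψ)
    (hW : W = fun x => (fderiv ℝ ψ x (b i₁)) • b i₀ - (fderiv ℝ ψ x (b i₀)) • b i₁) (x : E) :
    VectorCalculus.divergence W x = 0 := by
  have hg : ∀ k, HasFDerivAt (fun y => fderiv ℝ ψ y (b k)) (fderiv ℝ (fderiv ℝ ψ) x (b k)) x := by
    intro k
    have hd : DifferentiableAt ℝ (fun y => fderiv ℝ ψ y (b k)) x :=
      (((hψ.fderiv_right (m := 1) le_rfl).clm_apply contDiff_const).differentiable one_ne_zero) x
    rw [← fderiv_fderiv_apply_eq hψ x (b k)]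
    exact hd.hasFDerivAt
  have hD : HasFDerivAt W ((fderiv ℝ (fderiv ℝ ψ) x (b i₁)).smulRight (b i₀) -
      (fderiv ℝ (fderiv ℝ ψ) x (b i₀)).smulRight (b i₁)) x := by
    rw [hW]
    exact ((hg i₁).smul_const (b i₀)).sub ((hg i₀).smul_const (b i₁))
  rw [divergence_eq_traceCLM, hD.fderiv, map_sub, traceCLM_smulRight, traceCLM_smulRight]
  have hs := (hψ.contDiffAt (x := x)).isSymmSndFDerivAt (n := 2) (by simp)
  rw [hs.eq (b i₁) (b i₀), sub_self]

omit [FiniteDimensional ℝ E] in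
/-- The `b₁`-coordinate of the planar field is `−∂₀ψ` (for `i₀ ≠ i₁`). [folklore] -/
theorem inner_planarField (h01 : i₀ ≠ i₁)
    (hW : W = fun x => (fderiv ℝ ψ x (b i₁)) • b i₀ - (fderiv ℝ ψ x (b i₀)) • b i₁) (x : E) :
    ⟪b i₁, W x⟫ = -fderiv ℝ ψ x (b i₀) := by
  rw [hW]
  have h0 : ⟪b i₁, b i₀⟫ = 0 := b.orthonormal.2 (Ne.symm h01)
  have h1 : ⟪b i₁, b i₁⟫ = 1 := by rw [real_inner_self_eq_norm_sq, b.orthonormal.1 i₁, one_pow]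
  simp only [inner_sub_right, real_inner_smul_right, h0, h1]
  ring

omit [FiniteDimensional ℝ E] in
/-- **The planar field of a genuine bump is not identically zero.** If `ψ ∈ C¹` takes different
values at `p` and at some point `p + t₀ b₀` of the `b₀`-axis through `p` (`i₀ ≠ i₁`), then
`W = ∂₁ψ b₀ − ∂₀ψ b₁` does not vanish identically: otherwise `∂₀ψ ≡ 0`, and `t ↦ ψ(p + t b₀)` would
be constant (mean value theorem, Mathlib `is_const_of_deriv_eq_zero`). [folklore] -/
theorem exists_planarField_ne_zero (h01 : i₀ ≠ i₁) (hψ : ContDiff ℝ 1 ψ)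
    (hW : W = fun x => (fderiv ℝ ψ x (b i₁)) • b i₀ - (fderiv ℝ ψ x (b i₀)) • b i₁) {p : E}
    {t₀ : ℝ} (hp : ψ (p + t₀ • b i₀) ≠ ψ p) : ∃ x, W x ≠ 0 := by
  by_contra h
  push Not at h
  -- `∂₀ ψ ≡ 0`
  have h0 : ∀ x, fderiv ℝ ψ x (b i₀) = 0 := fun x => by
    have h1 := inner_planarField b h01 hW x
    rw [h x, inner_zero_right] at h1
    linarith
  -- `ψ` is constant along the `b₀`-axis through `p`
  set g : ℝ → ℝ := fun t => ψ (p + t • b i₀) with hg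
  have hgd : ∀ t, HasDerivAt g 0 t := fun t => by
    have h1 : HasDerivAt (fun s : ℝ => p + s • b i₀) ((1 : ℝ) • b i₀) t :=
      ((hasDerivAt_id t).smul_const (b i₀)).const_add p
    have h2 : HasFDerivAt ψ (fderiv ℝ ψ (p + t • b i₀)) (p + t • b i₀) :=
      (hψ.differentiable one_ne_zero _).hasFDerivAt
    have h3 := h2.comp_hasDerivAt t h1
    rw [one_smul, h0] at h3
    exact h3
  have hconst : g t₀ = g 0 :=
    is_const_of_deriv_eq_zero (fun t => (hgd t).differentiableAt) (fun t => (hgd t).deriv) t₀ 0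
  simp only [hg, zero_smul, add_zero] at hconst
  exact hp hconst

end Planar

end Literature.Analysis.FluidPDE
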